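import Literature.AlgebraicGeometry.HodgeTheory.FermatSurfaceLineFamilies
import Literature.AlgebraicGeometry.HodgeTheory.ThomGysinConcurrentFamily
import HarnessLib

/-!
# The plane sections `x_{2q} = v x_{2q+1}` of the Fermat surface of degree `m`: `m` concurrent lines spanning the classes supported on them

Family `hodge`, layer `Literature/AlgebraicGeometry/HodgeTheory`. Sequel of `FermatSurfaceLines` (the
lines `L(u, u') : x₀ = u x₁, x₂ = u' x₃`, `uᵐ = u'ᵐ = -1`, of `X = X²ₘ ⊂ ℙ³_ℂ`, their embeddings
`FermatSurface.lineEmb` and classes `FermatSurface.lineClass`). For `q ∈ {0, 1}` and a root `v` of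
`-1`, the plane `Π : x_{2q} = v x_{2q+1}` cuts `X` in the `m` lines of slopes `(v, u)` resp. `(u, v)`,
`u` running over the roots of `-1` (Shioda, Math. Ann. 245 (1979) §1; for `m = 3` the tritangent
planes of the Fermat cubic, Hartshorne V Ex. 4.16, treated in `FermatCubicSurfaceLineClasses`):

* `FermatSurface.planeLine q v u` — the slopes of the lines of `Π ∩ X`; they are CONCURRENT at the
  apex `[v : 1 : 0 : 0]` resp. `[0 : 0 : v : 1]` (`FermatSurface.apex_eq`) and two of them meet only
  there (`FermatSurface.eq_apex_of_mem_of_mem`);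
* `FermatSurface.planeEmb m q v : X ↪ ℙ³ ↪ ℙ⁴`, `[x] ↦ [x_{2q} - v x_{2q+1} : x₀ : ⋯ : x₃]` — off the
  `m` lines the new coordinate `y₀` does not vanish (`FermatSurface.mem_stdChartSource_of_not_mem`:
  `x_{2q} = v x_{2q+1}` on `X` forces `x_{2q'}ᵐ + x_{2q'+1}ᵐ = 0` for the other pair), so every class
  restricted from `ℙ⁴` dies off `Π ∩ X` (`FermatSurface.restrictCompl_planeLines_map_planeEmb`, the
  complement lying over the contractible chart `{y₀ ≠ 0}`);
* `FermatSurface.exists_eq_sum_smul_lineClass` — **every class of `H²(X(ℂ); ℂ)` dying off `Π ∩ X` is a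
  linear combination `Σᵤ sᵤ cl(L(v, u))` of the `m` line classes** (Deligne, Hodge III, Cor. 8.2.8 `⊆`,
  through the tree's `exists_eq_sum_smul_complexGysin_one_of_concurrent`, whose Čech hypothesis holds
  for concurrent families).

Theorems only (the definitions `planeLine`, `apexVec`, `planeSubst`, `planeEmb`, `negRoots` are in
`FermatSurfaceLineFamilies`); no named facts.

## References

* [Shioda1979HodgeFermat] T. Shioda, The Hodge conjecture for Fermat varieties, Math. Ann. 245 (1979), §1.
* [Hartshorne1977] R. Hartshorne, Algebraic Geometry (1977), V Ex. 4.16, V Prop. 1.4, II Example 7.1.1,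
  II Ex. 3.12.
* [DeligneHodgeIII1974] P. Deligne, Théorie de Hodge III, Prop. 8.2.7, Cor. 8.2.8.
-/

noncomputable section

open scoped LinearAlgebra.Projectivization
open CategoryTheory AlgebraicGeometry MvPolynomial
open Literature.AlgebraicGeometry.Motives Literature.AlgebraicTopology.SingularHomology
open Literature.NumberTheory.Transcendental

namespace Literature.AlgebraicGeometry.HodgeTheory

namespace FermatSurface

variable {m : ℕ}

variable (μ : OrientationFamily)

/-! ### The plane sections `x_{2q} = v x_{2q+1}`: `m` concurrent lines -/

/-- **The point of parameter `e_q` on every line of the plane section has coordinates `apexVec q v`**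
(independent of the second slope `u`). [cite: Hartshorne1977, V Ex. 4.16] -/
theorem lineVec_planeLine_single (q : Fin 2) (v u : ℂ) :
    lineVec (planeLine q v u) (Pi.single q 1) = apexVec q v := by
  obtain rfl | rfl : q = 0 ∨ q = 1 := by fin_cases q <;> simp
  · refine _root_.funext (forall_fin_four ?_ ?_ ?_ ?_) <;> simp [lineVec, apexVec, planeLine]
  · refine _root_.funext (forall_fin_four ?_ ?_ ?_ ?_) <;> simp [lineVec, apexVec, planeLine]

/-- The homogeneous coordinates of `g_{q,v,u}(e_q)` are `apexVec q v`. [cite: Hartshorne1977, V Ex. 4.16] -/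
theorem hypersurfacePoint_apex (q : Fin 2) {v u : ℂ} (hv : v ^ m = -1) (hu : u ^ m = -1) :
    hypersurfacePoint (SmoothHypersurface.hypersurfaceι (fermatPolynomial ℂ (2 * 1) m)) (AlgPoints.map (lineEmb m (planeLine q v u) (planeLine_pow q hv hu))
      (projPoint 1 (Projectivization.mk ℂ (Pi.single q 1) (single_ne_zero q)))) =
      Projectivization.mk ℂ (apexVec q v) (apexVec_ne_zero q v) := by
  rw [hypersurfacePoint_map_lineEmb]
  exact (Projectivization.mk_eq_mk_iff' ℂ _ _ _ _).mpr
    ⟨1, by rw [one_smul]; exact (lineVec_planeLine_single q v u).symm⟩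

/-- **The lines of a plane section are concurrent**: the points `g_{q,v,u}(e_q)` coincide.
[cite: Hartshorne1977, V Ex. 4.16] -/
theorem apex_eq (q : Fin 2) {v u u' : ℂ} (hv : v ^ m = -1) (hu : u ^ m = -1) (hu' : u' ^ m = -1) :
    AlgPoints.map (lineEmb m (planeLine q v u) (planeLine_pow q hv hu))
        (projPoint 1 (Projectivization.mk ℂ (Pi.single q 1) (single_ne_zero q))) =
      AlgPoints.map (lineEmb m (planeLine q v u') (planeLine_pow q hv hu'))
        (projPoint 1 (Projectivization.mk ℂ (Pi.single q 1) (single_ne_zero q))) :=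
  (isEmbedding_hypersurfacePoint (SmoothHypersurface.hypersurfaceι (fermatPolynomial ℂ (2 * 1) m))).injective (by
    rw [hypersurfacePoint_apex q hv hu, hypersurfacePoint_apex q hv hu'])

/-- The apex lies on every line of the plane section. [cite: Hartshorne1977, V Ex. 4.16] -/
theorem apex_pt_mem_range (q : Fin 2) {v u u' : ℂ} (hv : v ^ m = -1) (hu : u ^ m = -1)
    (hu' : u' ^ m = -1) :
    (AlgPoints.map (lineEmb m (planeLine q v u) (planeLine_pow q hv hu))
        (projPoint 1 (Projectivization.mk ℂ (Pi.single q 1) (single_ne_zero q)))).pt ∈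
      Set.range (lineEmb m (planeLine q v u') (planeLine_pow q hv hu')).left.base := by
  rw [apex_eq q hv hu hu']
  exact ⟨_, rfl⟩

/-- **Two distinct lines of a plane section meet only at the apex**: a complex point on the lines of
second slopes `u ≠ u'` has coordinates proportional to `apexVec q v`.
[cite: Hartshorne1977, V Ex. 4.16] -/
theorem eq_apex_of_mem_of_mem (q : Fin 2) {v u u' : ℂ} (hv : v ^ m = -1) (hu : u ^ m = -1)
    (hu' : u' ^ m = -1) (huu : u ≠ u') (P : ComplexPoints (fermatHypersurface (2 * 1) m))
    (hP : P.pt ∈ Set.range (lineEmb m (planeLine q v u) (planeLine_pow q hv hu)).left.base)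
    (hP' : P.pt ∈ Set.range (lineEmb m (planeLine q v u') (planeLine_pow q hv hu')).left.base) :
    P = AlgPoints.map (lineEmb m (planeLine q v u) (planeLine_pow q hv hu))
      (projPoint 1 (Projectivization.mk ℂ (Pi.single q 1) (single_ne_zero q))) := by
  rw [pt_mem_range_lineEmb_iff_rep] at hP hP'
  set z := (hypersurfacePoint (SmoothHypersurface.hypersurfaceι (fermatPolynomial ℂ (2 * 1) m)) P).rep with hz
  apply (isEmbedding_hypersurfacePoint (SmoothHypersurface.hypersurfaceι (fermatPolynomial ℂ (2 * 1) m))).injective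
  rw [hypersurfacePoint_apex q hv hu, ← Projectivization.mk_rep (hypersurfacePoint (SmoothHypersurface.hypersurfaceι (fermatPolynomial ℂ (2 * 1) m)) P)]
  refine (Projectivization.mk_eq_mk_iff' ℂ _ _ _ _).mpr ?_
  obtain rfl | rfl : q = 0 ∨ q = 1 := by fin_cases q <;> simp
  · -- `x₀ = v x₁` fixed, second slopes `u ≠ u'`: `z₃ = 0 = z₂`, `z = z₁ • (v, 1, 0, 0)`
    simp only [planeLine_self, planeLine_of_ne (show (1 : Fin 2) ≠ 0 by decide)] at hP hP'
    have hz3 : z 3 = 0 := by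
      have h : (u - u') * z 3 = 0 := by rw [sub_mul, ← hP.2, ← hP'.2, sub_self]
      exact (mul_eq_zero.mp h).resolve_left (sub_ne_zero.mpr huu)
    have hz2 : z 2 = 0 := by rw [hP.2, hz3, mul_zero]
    have e0 : z 1 • apexVec 0 v 0 = z 0 := by rw [hP.1]; simp [apexVec, mul_comm]
    have e1 : z 1 • apexVec 0 v 1 = z 1 := by simp [apexVec]
    have e2 : z 1 • apexVec 0 v 2 = z 2 := by rw [hz2]; simp [apexVec]
    have e3 : z 1 • apexVec 0 v 3 = z 3 := by rw [hz3]; simp [apexVec]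
    exact ⟨z 1, _root_.funext (forall_fin_four (P := fun i ↦ (z 1 • apexVec 0 v) i = z i) e0 e1 e2 e3)⟩
  · -- `x₂ = v x₃` fixed, first slopes `u ≠ u'`: `z₁ = 0 = z₀`, `z = z₃ • (0, 0, v, 1)`
    simp only [planeLine_self, planeLine_of_ne (show (0 : Fin 2) ≠ 1 by decide)] at hP hP'
    have hz1 : z 1 = 0 := by
      have h : (u - u') * z 1 = 0 := by rw [sub_mul, ← hP.1, ← hP'.1, sub_self]
      exact (mul_eq_zero.mp h).resolve_left (sub_ne_zero.mpr huu)
    have hz0 : z 0 = 0 := by rw [hP.1, hz1, mul_zero]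
    have e0 : z 3 • apexVec 1 v 0 = z 0 := by rw [hz0]; simp [apexVec]
    have e1 : z 3 • apexVec 1 v 1 = z 1 := by rw [hz1]; simp [apexVec]
    have e2 : z 3 • apexVec 1 v 2 = z 2 := by rw [hP.2]; simp [apexVec, mul_comm]
    have e3 : z 3 • apexVec 1 v 3 = z 3 := by simp [apexVec]
    exact ⟨z 3, _root_.funext (forall_fin_four (P := fun i ↦ (z 3 • apexVec 1 v) i = z i) e0 e1 e2 e3)⟩

/-! ### Off the plane section the new coordinate `y₀ = x_{2q} - v x_{2q+1}` does not vanish -/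

/-- **The complex points of `X²ₘ` off the `m` lines of the plane `x_{2q} = v x_{2q+1}` lie over the
chart `{y₀ ≠ 0}` of `ℙ⁴`**: if `z_{2q} = v z_{2q+1}` at `P = [z] ∈ X(ℂ)` then (as `vᵐ = -1`) the other
pair has `z_{2q'}ᵐ + z_{2q'+1}ᵐ = 0`, so `z_{2q'} = u z_{2q'+1}` for a root `u` of `-1` and `P` lies on
the line of slopes `(v, u)` (`X ∩ Π = ⋃ᵤ L`). [cite: Shioda1979HodgeFermat, §1] [cite: Hartshorne1977, V Ex. 4.16] -/
theorem mem_stdChartSource_of_not_mem (hm : 1 ≤ m) (q : Fin 2) {v : ℂ} (hv : v ^ m = -1)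
    (P : ComplexPoints (fermatHypersurface (2 * 1) m))
    (hP : P.pt ∉ ⋃ u : negRoots m, Set.range
      (lineEmb m (planeLine q v u) (planeLine_pow q hv (pow_eq_of_mem_negRoots hm u))).left.base) :
    hypersurfacePoint (planeEmb m q v) P ∈ Projectivization.stdChartSource 0 := by
  set z := (hypersurfacePoint (SmoothHypersurface.hypersurfaceι (fermatPolynomial ℂ (2 * 1) m)) P).rep with hzdef
  have hz0 : z ≠ 0 := Projectivization.rep_nonzero _
  -- the coordinates of `P` in `ℙ⁴`
  have hcoord : hypersurfacePoint (planeEmb m q v) P =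
      Projectivization.mk ℂ (fun i ↦ aeval z (planeSubst q v i))
        (ProjectiveSpace.linSubstVec_ne_zero _ (exists_planeSubst_eq_X q v) hz0) := by
    refine hypersurfacePoint_eq_of_projPoint_eq _ _ ?_
    rw [planeEmb, AlgPoints.map_comp_apply, ← projPoint_hypersurfacePoint (SmoothHypersurface.hypersurfaceι (fermatPolynomial ℂ (2 * 1) m)) P,
      ← Projectivization.mk_rep (hypersurfacePoint (SmoothHypersurface.hypersurfaceι (fermatPolynomial ℂ (2 * 1) m)) P)]
    exact (Motives.map_linSubstMap_projPoint_mk _ _ _ z hz0).symm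
  -- `F(z) = 0`
  have hF : z 0 ^ m + z 1 ^ m + z 2 ^ m + z 3 ^ m = 0 := by
    have hmem := hypersurfacePoint_mem_projZeroLocus (ι := SmoothHypersurface.hypersurfaceι (fermatPolynomial ℂ (2 * 1) m)) (isHomogeneous_fermatPolynomial (2 * 1) m)
      (SmoothHypersurface.range_hypersurfaceι _) P
    have h := hmem (fermatPolynomial ℂ (2 * 1) m) rfl
    have hev : MvPolynomial.eval z (fermatPolynomial ℂ (2 * 1) m) = ∑ i, z i ^ m := by
      simp [fermatPolynomial, map_sum]
    rw [hev, Fin.sum_univ_four] at h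
    exact h
  rw [hcoord, Projectivization.mk_mem_stdChartSource_iff, aeval_planeSubst_zero]
  intro h0
  apply hP
  have h0' : z (pairFst q) = v * z (pairSnd q) := sub_eq_zero.mp h0
  obtain rfl | rfl : q = 0 ∨ q = 1 := by fin_cases q <;> simp
  · -- `z₀ = v z₁`, hence `z₂ᵐ + z₃ᵐ = 0`
    change z 0 = v * z 1 at h0'
    have h23 : z 2 ^ m + z 3 ^ m = 0 := by
      rw [h0'] at hF
      linear_combination hF - z 1 ^ m * hv
    obtain ⟨u, hu⟩ := exists_eq_negRoot_mul hm hv h23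
    refine Set.mem_iUnion.mpr ⟨u, ?_⟩
    rw [pt_mem_range_lineEmb_iff_rep, planeLine_self, planeLine_of_ne (show (1 : Fin 2) ≠ 0 by decide)]
    exact ⟨h0', hu⟩
  · -- `z₂ = v z₃`, hence `z₀ᵐ + z₁ᵐ = 0`
    change z 2 = v * z 3 at h0'
    have h01 : z 0 ^ m + z 1 ^ m = 0 := by
      rw [h0'] at hF
      linear_combination hF - z 3 ^ m * hv
    obtain ⟨u, hu⟩ := exists_eq_negRoot_mul hm hv h01
    refine Set.mem_iUnion.mpr ⟨u, ?_⟩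
    rw [pt_mem_range_lineEmb_iff_rep, planeLine_self, planeLine_of_ne (show (0 : Fin 2) ≠ 1 by decide)]
    exact ⟨hu, h0'⟩

/-- **A class restricted from `ℙ⁴` along the re-embedding dies off the plane section**: the
complement of the `m` lines lies over the contractible chart `{y₀ ≠ 0}`
(`restrictCompl_map_eq_zero_of_stdChartSource`). [cite: Hartshorne1977, V Prop. 1.4] -/
theorem restrictCompl_planeLines_map_planeEmb (hm : 1 ≤ m) (q : Fin 2) {v : ℂ} (hv : v ^ m = -1)
    (r₀ : complexBetti (Motives.projectiveSpace 4 ℂ) (2 * 1)) :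
    complexBetti.restrictCompl (fermatHypersurface (2 * 1) m) (⋃ u : negRoots m, Set.range
      (lineEmb m (planeLine q v u) (planeLine_pow q hv (pow_eq_of_mem_negRoots hm u))).left.base)
      (2 * 1) (complexBetti.map (planeEmb m q v) (2 * 1) r₀) = 0 :=
  restrictCompl_map_eq_zero_of_stdChartSource (planeEmb m q v) 0
    (mem_stdChartSource_of_not_mem hm q hv) (by norm_num) r₀

/-! ### Classes dying off a plane section are combinations of its line classes -/

/-- **A class of `H²(X²ₘ(ℂ); ℂ)` dying off the plane section `X ∩ {x_{2q} = v x_{2q+1}} = ⋃ᵤ L(v, u)`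
is a linear combination of the `m` line classes**: Deligne's Cor. 8.2.8 `⊆` for the finite
concurrent family of the lines of the plane (`exists_eq_sum_smul_complexGysin_one_of_concurrent`,
its Čech hypothesis verified by concurrency at the apex). [cite: DeligneHodgeIII1974, Cor. 8.2.8]
[cite: Hartshorne1977, V Prop. 1.4] -/
theorem exists_eq_sum_smul_lineClass (hm : 1 ≤ m) (q : Fin 2) {v : ℂ} (hv : v ^ m = -1)
    (x : complexBetti (fermatHypersurface (2 * 1) m) (2 * 1))
    (hx : complexBetti.restrictCompl (fermatHypersurface (2 * 1) m) (⋃ u : negRoots m, Set.range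
      (lineEmb m (planeLine q v u) (planeLine_pow q hv (pow_eq_of_mem_negRoots hm u))).left.base)
      (2 * 1) x = 0) :
    ∃ s : negRoots m → ℂ, x = ∑ u, s u •
      lineClass μ m (planeLine q v u) (planeLine_pow q hv (pow_eq_of_mem_negRoots hm u)) hm := by
  have hne : (negRoots m).Nonempty := ⟨v, (mem_negRoots hm).mpr hv⟩
  obtain ⟨u₀, hu₀⟩ := hne
  exact exists_eq_sum_smul_complexGysin_one_of_concurrent μ (isSmoothProjective_X hm) (m := 1)
    (fun _ ↦ isSmoothProjective_projectiveSpace' 1)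
    (fun u : negRoots m ↦ lineEmb m (planeLine q v u) (planeLine_pow q hv (pow_eq_of_mem_negRoots hm u)))
    (AlgPoints.map (lineEmb m (planeLine q v u₀) (planeLine_pow q hv ((mem_negRoots hm).mp hu₀)))
      (projPoint 1 (Projectivization.mk ℂ (Pi.single q 1) (single_ne_zero q))))
    (fun u ↦ apex_pt_mem_range q hv ((mem_negRoots hm).mp hu₀) (pow_eq_of_mem_negRoots hm u))
    (fun u u' huu P hP hP' ↦ by
      rw [eq_apex_of_mem_of_mem q hv (pow_eq_of_mem_negRoots hm u) (pow_eq_of_mem_negRoots hm u')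
        (fun h ↦ huu (Subtype.ext h)) P hP hP']
      exact apex_eq q hv (pow_eq_of_mem_negRoots hm u) ((mem_negRoots hm).mp hu₀))
    (p := 1) one_ne_zero (by norm_num) (by norm_num) x hx

end FermatSurface

end Literature.AlgebraicGeometry.HodgeTheory

end
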